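import Summits.QuantumFields.BalabanUV.Beta.GAN24.RespStepBmGaugeStep
import Literature.MathematicalPhysics.QuantumFieldTheory.Balaban1983to89.Beta.PeriodicDescent

/-!
# `BalabanUV.Beta.GAN24.RespStepBmGaugeLaw` — binder row G-an2-4 / (CONV-C), S-slot on the literal of record (family (E), road «SREC», row V4-b, part 3):
# THE DRESSED ONE-STEP GAUGE LAW WITH ITS CONSTANT — `T (d_c ψ) = d ((L^{d+1})⁻¹ • ψ ∘ blk_L)` EXACTLY (`N′ = M·L`, in-block root, summable `ψ`),
# for the dressed `respStep` legs and for the dressed one-step leg `colH (coDressKBmAt ρ Lc K̃_m) Lc` of the (E) recursion in units (`κ = (Lc^{d+1})⁻¹`)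

NOT IN PRINT; OUR BOOKKEEPING (idle-seat piece «SREC-GAUGESTEP» = RULINGS-15b (R15-5) of the row owner `b2b-balaban-gan24-p1`, row V4-b; part 3 after
`GAN24/AxProjBmWindow` p228427 and `GAN24/RespStepBmGaugeStep` p228669 — answers the row owner gen 13's O13-1 «κ read off V4-b» (journal l.18098): the block
means of the flat potential ARE fixed by the constraint, no Poincaré datum survives).  HONEST FRAMING (cell contract, verbatim): «discharging `BetaPertH` makes
Bałaban's UV stability UNCONDITIONAL — a real constructive-QFT result; it is NOT the continuum limit and NOT the Clay problem.»  HONEST DEPENDENCY (verbatim):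
«continuum YM on T⁴ ⇐ BetaPertH ∧ nine spine estimates (0/9 proved); BetaPertH ⇐ (D1) ∧ (D4) ∧ CAP+tail; G-an2-4 gates asym, D1 and NE2/3/4.»  [folklore]
assembly of tree theorems BY NAME — parts 1–2, an5's `ResolventComposition.contourSum_HcolSum` ∕ `contourSum_mul` ((Q)-normalisation and the semigroup law of
block-contour sums), the lead's `contourSum_dz`, an2's `axProjBmAt_dz`, `PeriodicDescent.const_of_dz_eq_zero` (ℤ^{d+1} is connected); generic dimension;
NO estimate, NO cited fact, NO `def`, NO `def … : Prop`, NO wall binder; reserved families untouched.  Discharges NOTHING of (hS, hSall) on (E); NOT D1, NOT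
BetaPertH, NOT continuum, NOT Clay.

## Contents ([folklore])
§6 `contourSum_exactResponse_tsum_self` (the level-`N′` (Q)-normalisation of the ψ-weighted series of elementary exact responses IS `dz ψ`),
   `blockSum_potential_eq` (`N′ = M·L`: the `L`-block sums of the `M`-block sums of ANY potential `g` of the response are `ψ` up to ONE additive constant),
   **`dressedStep_exact_eq`**: `(l″,w′) ↦ Σ_μ Σ'_z (dz ψ)(μ,z) · coProjBmW ρ L (respStep M N′ μ z) (l″,w′) = dz (w′ ↦ (L^{d+1})⁻¹ · ψ (blk L w′))`, and the instance of
   record **`dressedLeg_KStepUnit_exact_eq`** (`L = Lc`, `M = Lc^m`, `N′ = Lc^(m+1)`): the dressed one-step leg of (E) in units maps `d_c ψ` to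
   `d ((Lc^{d+1})⁻¹ • ψ ∘ blk_{Lc})` — the pure-gauge datum is transported to the next level as a BLOCK-CONSTANT pure gauge with the FIXED factor `(Lc^{d+1})⁻¹`
   and no other memory of the minimiser.
Unit `b2b-balaban-gan24-p4` (road P4 seat in custody, gen 27), 2026-08-20.
-/

noncomputable section

open Finset
open scoped BigOperators
open Literature.MathematicalPhysics.QuantumFieldTheory
open Literature.MathematicalPhysics.QuantumFieldTheory.Balaban1983to89
open Literature.MathematicalPhysics.QuantumFieldTheory.Balaban1983to89.Beta
open AffineAveraging (Form0 Form1 Site box toSite unitVec unitVec_apply curv dz blockSum contourSum contourSum_dz)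
open AveragingContours (blk)
open ResolventComposition (Hcol HcolSum Tex cex sum_Tex exists_dz_eq_of_curv_eq_zero contourSum_tsum contourSum_const_mul contourSum_HcolSum
  contourSum_mul)
open BalabanCompositeJets (respStep)
open OneStepKernelFamily (colH)
open Summit.QuantumFields.BalabanUV.Beta.AxialProjectorBlockMean (blockMeanAt axProjBmAt)
open Summit.QuantumFields.BalabanUV.Beta.AxialDressingRooted (coProjBmW coDressKBmAt)
open Summit.QuantumFields.BalabanUV.Beta.BorderedHessian (axProjBmAt_dz)
open Summit.QuantumFields.BalabanUV.Beta.GAN24.RespStepBmGauge (curv_exactResponse_tsum_eq_zero summable_exactResponse_term)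
open Summit.QuantumFields.BalabanUV.Beta.GAN24.CombesThomas (KStepUnit)
open Summit.QuantumFields.BalabanUV.Beta.GAN24.AxProjBmWindow (axProjBmAt_eq_coProjBmW)
open Summit.QuantumFields.BalabanUV.Beta.GAN24.RespStepBmGaugeStep (exists_abs_respStep_le sum_tsum_mul_coProjBmW sum_tsum_dz_mul_respStep_eq
  colH_coDressKBmAt_KStepUnit)

namespace Summit.QuantumFields.BalabanUV.Beta.GAN24.RespStepBmGaugeLaw

variable {d : ℕ}

/-! ## §6 The dressed one-step gauge law with its constant -/

section Law

variable {N' : ℕ} [NeZero N']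

/-- [folklore] **THE (Q)-NORMALISATION ON THE ψ-WEIGHTED SERIES OF ELEMENTARY EXACT RESPONSES**: `𝒬_{N′} (Σ'_{y₀} ψ y₀ • ℋ_{N′}(−d_c δ_{y₀})) = dz ψ` (summable `ψ`;
an5's `contourSum_HcolSum` — `𝒬_{N′} ℋ_{N′}(·; t) = δ_t` — and `cex y₀ = δ_{y₀ − e_κ} − δ_{y₀}` read at `(κ, y)`). -/
theorem contourSum_exactResponse_tsum_self {ψ : Site (d + 1) → ℝ} (hψ : Summable ψ) :
    contourSum N' (fun κ x => ∑' y₀, ψ y₀ * HcolSum (N := N') (Tex y₀) (cex y₀) κ x) = dz ψ := by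
  funext κ y
  rw [contourSum_tsum (fun y₀ κ x => ψ y₀ * HcolSum (N := N') (Tex y₀) (cex y₀) κ x) (fun κ x => summable_exactResponse_term hψ κ x)]
  have hterm : ∀ y₀, contourSum N' (fun κ x => ψ y₀ * HcolSum (N := N') (Tex y₀) (cex y₀) κ x) κ y
      = ψ y₀ * ((if y₀ = y + unitVec κ then 1 else 0) - (if y₀ = y then 1 else 0)) := by
    intro y₀
    rw [contourSum_const_mul, contourSum_HcolSum, sum_Tex y₀ (fun t => if y = t.2 ∧ κ = t.1 then (1 : ℝ) else 0)]
    congr 1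
    rw [Finset.sum_eq_single_of_mem κ (Finset.mem_univ κ) (fun l _ hl => by
      rw [if_neg (fun h => hl h.2.symm), if_neg (fun h => hl h.2.symm), sub_zero])]
    simp only [and_true]
    congr 1
    · by_cases h : y₀ = y + unitVec κ
      · rw [if_pos h, if_pos (by rw [h, add_sub_cancel_right])]
      · rw [if_neg h, if_neg (fun h' => h (by rw [h', sub_add_cancel]))]
    · by_cases h : y₀ = y
      · rw [if_pos h, if_pos h.symm]
      · rw [if_neg h, if_neg (fun h' => h h'.symm)]
  simp only [hterm, mul_sub, mul_ite, mul_one, mul_zero]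
  rw [Summable.tsum_sub (summable_of_ne_finset_zero (s := {y + unitVec κ}) (fun y₀ hy₀ => by
      rw [Finset.mem_singleton] at hy₀; rw [if_neg hy₀]))
    (summable_of_ne_finset_zero (s := {y}) (fun y₀ hy₀ => by rw [Finset.mem_singleton] at hy₀; rw [if_neg hy₀])),
    tsum_ite_eq, tsum_ite_eq]
  rfl

/-- [folklore] **THE BLOCK SUMS OF THE FLAT POTENTIAL ARE FIXED BY THE CONSTRAINT** (`N′ = M·L`, `0 < M`): for ANY potential `g` of the ψ-weighted series of
elementary exact responses, the `L`-block sums of its `M`-block sums are `ψ` up to ONE additive constant — `(Q)`-normalisation (`contourSum_exactResponse_tsum_self`),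
the semigroup law `𝒬_{M·L} = 𝒬_L ∘ 𝒬_M` (an5's `contourSum_mul`), `contourSum_dz` twice, and `dz h = 0 ⇒ h` constant (`PeriodicDescent.const_of_dz_eq_zero`). -/
theorem blockSum_potential_eq {M L : ℕ} (hM : 0 < M) (hN' : N' = M * L) {ψ : Site (d + 1) → ℝ} (hψ : Summable ψ) {g : Form0 (d + 1) ℝ}
    (hg : dz g = fun κ x => ∑' y₀, ψ y₀ * HcolSum (N := N') (Tex y₀) (cex y₀) κ x) (y : Site (d + 1)) :
    blockSum L (blockSum M g) y = ψ y + (blockSum L (blockSum M g) 0 - ψ 0) := by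
  have hQ := contourSum_exactResponse_tsum_self (N' := N') hψ
  rw [← hg, hN', contourSum_mul M L hM, contourSum_dz, contourSum_dz] at hQ
  -- `dz (blockSum L (blockSum M g) - ψ) = 0`
  have h0 : dz (blockSum L (blockSum M g) - ψ) = 0 := by
    rw [AffineReproduction.dz_sub, hQ, sub_self]
  have hc := PeriodicDescent.const_of_dz_eq_zero _ h0 y
  simp only [Pi.sub_apply] at hc
  linarith

/-- [folklore] **THE DRESSED ONE-STEP GAUGE LAW WITH ITS CONSTANT** (in-block root `ρ = toSite r`, dressing blocking `L ≥ 1` on the level-`M` lattice, `N′ = M·L`,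
`0 < M`, summable `ψ`): the dressed `respStep` legs transport the exact coarse datum `d_c ψ` to the BLOCK-CONSTANT pure gauge `d ((L^{d+1})⁻¹ • ψ ∘ blk_L)`:
`(l″,w′) ↦ Σ_μ Σ'_z (dz ψ)(μ,z) · coProjBmW ρ L (respStep M N′ μ z) (l″,w′) = dz (w′ ↦ (L^{d+1})⁻¹ · ψ (blk L w′))`
(part 2's operator form + `axProjBmAt_dz` + `blockSum_potential_eq`: `blockMeanAt L (blockSum M g) = ((L^{d+1})⁻¹ • blockSum N′ g) ∘ blk_L`). -/
theorem dressedStep_exact_eq {L : ℕ} (hL : 1 ≤ L) {r : Fin (d + 1) → ℕ} (hr : r ∈ box (d + 1) L) {M : ℕ} (hM : 0 < M) (hN' : N' = M * L)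
    {ψ : Site (d + 1) → ℝ} (hψ : Summable ψ) :
    (fun l'' w' => ∑ μ, ∑' z, dz ψ μ z * coProjBmW (toSite r) L (respStep (d := d) M N' μ z) l'' w')
      = dz (fun w' => (((L : ℝ) ^ (d + 1))⁻¹) * ψ (blk L w')) := by
  obtain ⟨C, hC⟩ := exists_abs_respStep_le (N' := N') (d := d) M
  obtain ⟨g, hg⟩ := exists_dz_eq_of_curv_eq_zero (curv_exactResponse_tsum_eq_zero (N := N') hψ)
  have e : (fun l'' w' => ∑ μ, ∑' z, dz ψ μ z * coProjBmW (toSite r) L (respStep (d := d) M N' μ z) l'' w')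
      = axProjBmAt (toSite r) L (contourSum M (fun κ x => ∑' y₀, ψ y₀ * HcolSum (N := N') (Tex y₀) (cex y₀) κ x)) := by
    funext l'' w'
    rw [sum_tsum_mul_coProjBmW (toSite r) L (fun μ => KKTFluctuationEnergy.summable_dz hψ μ) hC, axProjBmAt_eq_coProjBmW hL hr]
    congr 1
    funext κ u
    exact sum_tsum_dz_mul_respStep_eq hψ M κ u
  rw [e, ← hg, contourSum_dz, axProjBmAt_dz (toSite r) hL]
  funext μ w'
  set c : ℝ := blockSum L (blockSum M g) 0 - ψ 0 with hc
  have hb : ∀ y, blockSum L (blockSum M g) y = ψ y + c := fun y => blockSum_potential_eq (N' := N') hM hN' hψ hg y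
  simp only [dz, blockMeanAt]
  rw [hb, hb]
  ring

end Law

/-! ## §7 The instance of record: `L = Lc`, `M = Lc^m`, `N′ = Lc^(m+1)` — the factor is `(Lc^{d+1})⁻¹`, level-free -/

section Units

variable {Lc : ℕ} [NeZero Lc]

/-- [folklore] **THE DRESSED ONE-STEP LEG OF THE (E) RECURSION IN UNITS TRANSPORTS AN EXACT COARSE DATUM AS `d_c ψ ↦ d ((Lc^{d+1})⁻¹ • ψ ∘ blk_{Lc})`**
(in-block root, every level `m`, summable `ψ`): `(l″,w′) ↦ Σ_μ Σ'_z (dz ψ)(μ,z) · colH (coDressKBmAt ρ Lc K̃_m) Lc μ z l″ w′ = dz (w′ ↦ (Lc^{d+1})⁻¹ · ψ (blk Lc w′))` —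
the row owner's O13-1 recursion constant `κ = (Lc^{d+1})⁻¹`, LEVEL-FREE (the `(Lc^m)^{d+2}` of an2's `respStep_eq` is already absorbed in `K̃_m = KStepUnit Lc m`). -/
theorem dressedLeg_KStepUnit_exact_eq {r : Fin (d + 1) → ℕ} (hr : r ∈ box (d + 1) Lc) (m : ℕ) {ψ : Site (d + 1) → ℝ} (hψ : Summable ψ) :
    (fun l'' w' => ∑ μ, ∑' z, dz ψ μ z * colH (coDressKBmAt (toSite r) Lc (KStepUnit (d := d) Lc m)) Lc μ z l'' w')
      = dz (fun w' => (((Lc : ℝ) ^ (d + 1))⁻¹) * ψ (blk Lc w')) := by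
  have hLc : 0 < Lc := Nat.pos_of_ne_zero (NeZero.ne Lc)
  simp only [colH_coDressKBmAt_KStepUnit]
  exact dressedStep_exact_eq (N' := Lc ^ (m + 1)) hLc hr (pow_pos hLc m) (pow_succ Lc m) hψ

end Units

end Summit.QuantumFields.BalabanUV.Beta.GAN24.RespStepBmGaugeLaw

end
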